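/-
Soloist programme `solo-KontsevichZagierPeriods-blind`, session 3.
THE SHUFFLE PRODUCT AS A KZ MOVE: `Λ₂ × Λ₂ = 2Λ_(2,2) + 4Λ_(3,1)` by domain additivity;
with the stuffle, `ζ(3,1) = ζ(4)/4` inside the rules.
-/
import Summits.KontsevichZagierPeriods.KontsevichZagierPeriods.Theorems.SoloBlindStuffle
import Literature.NumberTheory.Transcendental.KZSemiCanonicalReductionProofs
import Literature.NumberTheory.Transcendental.MZVSimplexRepFubini
import Literature.NumberTheory.Transcendental.GenusZeroPeriodsMZVDimTwoProofs
import HarnessLib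

/-!
# The shuffle product inside the rules: `Λ₂ × Λ₂ ≡ 2Λ_(2,2) + 4Λ_(3,1)`, and `4ζ(3,1) = ζ(4)`

The *shuffle* product of iterated integrals is Kontsevich–Zagier's rule (1) in its other guise,
additivity of the DOMAIN: the product of two simplices `{1>t₀>t₁>0} × {1>t₂>t₃>0}` is, up to the
null set of ties, the disjoint union of the six cells on which the four coordinates are totally
ordered compatibly; each cell is a coordinate permutation (rule (2), `|det| = 1`) of the standard
simplex `Δ₄`, carrying the word read off the order of the letters `ω₀(t₀) ω₁(t₁) ω₀(t₂) ω₁(t₃)`: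
twice `0101 = ε(2,2)` and four times `0011 = ε(3,1)`.

* `kz_shuffle_two_two : of lamPair - 2 • of Λ_(2,2) - 4 • of Λ_(3,1) ∈ relations` (`lamPair =
  Λ₂ × Λ₂`) — one six-fold
  domain decomposition and six permutation charts;
* with the stuffle of `SoloBlindStuffle` (`[Λ₂ × Λ₂] ≡ 2[Λ_(2,2)] + [Λ₄]`), the weight-4 double
  shuffle relation **`kz_four_threeOne_sub_four : 4 • of Λ_(3,1) - of Λ₄ ∈ relations`**, its box
  form, and the value `4ζ(3,1) = ζ(4)` read off the moves (`four_mul_zeta_three_one`).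
-/

noncomputable section

namespace Summit.KontsevichZagierPeriods.KontsevichZagierPeriods.Theorems

open Set MeasureTheory
open Literature.NumberTheory.Transcendental
open Literature.NumberTheory.Transcendental.KZ

namespace SoloBlind

/-! ## The representations -/

/-- Kontsevich's `Λ₂ = [Δ₂, dt₀/t₀ · dt₁/(1-t₁)]`. -/
def lamTwo : IntegralRep 2 := simplexZetaRep 2 le_rfl

/-- `Λ₄`. -/
def lamFour : IntegralRep 4 := simplexZetaRep 4 (by norm_num)

/-- `Λ_(2,2)` (word `0101`). -/
def lamTwoTwo : IntegralRep 4 := mzvSimplexRep [2, 2] isAdmissible_two_two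

/-- `(3,1)` is admissible. -/
theorem isAdmissible_three_one : MZV.IsAdmissible [3, 1] :=
  MZV.isAdmissible_add_two_cons_replicate_one 1 1

/-- `Λ_(3,1)` (word `0011`). -/
def lamThreeOne : IntegralRep 4 := mzvSimplexRep [3, 1] isAdmissible_three_one

/-- `ε(3,1) = 0011`. -/
theorem binaryWord_three_one : MZV.binaryWord [3, 1] = [false, false, true, true] := by decide

/-- `ε(2) = 01`. -/
theorem binaryWord_two : MZV.binaryWord [2] = [false, true] := by decide

/-- Strict antitonicity on `Fin 4`. -/
theorem strictAnti_four_iff (t : Fin 4 → ℝ) :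
    StrictAnti t ↔ t 1 < t 0 ∧ t 2 < t 1 ∧ t 3 < t 2 := by
  rw [Fin.strictAnti_iff_succ_lt]
  exact ⟨fun h => ⟨h 0, h 1, h 2⟩, fun h i => by fin_cases i <;> simp [h.1, h.2.1, h.2.2]⟩

/-- `Δ₂ = {0 < t₁ < t₀ < 1}`. -/
theorem mem_openOrderedSimplex_two {t : Fin 2 → ℝ} :
    t ∈ openOrderedSimplex 2 ↔ 0 < t 1 ∧ t 1 < t 0 ∧ t 0 < 1 := by
  simp only [openOrderedSimplex, mem_setOf_eq, GenusZeroPeriodsMZV.strictAnti_fin_two_iff,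
    Fin.forall_fin_two]
  constructor
  · rintro ⟨⟨_, h1⟩, ⟨h0', _⟩, h10⟩; exact ⟨h1, h10, h0'⟩
  · rintro ⟨h1, h10, h0'⟩; exact ⟨⟨by linarith, h1⟩, ⟨h0', by linarith⟩, h10⟩

/-- `Δ₄ = {0 < t₃ < t₂ < t₁ < t₀ < 1}`. -/
theorem mem_openOrderedSimplex_four {t : Fin 4 → ℝ} :
    t ∈ openOrderedSimplex 4 ↔ 0 < t 3 ∧ t 3 < t 2 ∧ t 2 < t 1 ∧ t 1 < t 0 ∧ t 0 < 1 := by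
  simp only [openOrderedSimplex, mem_setOf_eq, strictAnti_four_iff]
  constructor
  · rintro ⟨hp, hl, h10, h21, h32⟩; exact ⟨hp 3, h32, h21, h10, hl 0⟩
  · rintro ⟨h3, h32, h21, h10, h0⟩
    refine ⟨fun i => ?_, fun i => ?_, h10, h21, h32⟩ <;> fin_cases i <;> simp <;> linarith

/-- The integrand of `Λ₂`. -/
theorem lamTwo_integrand (u : Fin 2 → ℝ) : lamTwo.integrand u = 1 / u 0 * (1 / (1 - u 1)) := by
  show (∏ i : Fin 2, mzvForm ((MZV.binaryWord [2]).getD i false) (u i)) = _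
  rw [binaryWord_two]
  simp only [Fin.prod_univ_two, Fin.val_zero, Fin.val_one, List.getD_cons_zero,
    List.getD_cons_succ, mzvForm_false, mzvForm_true]

/-- The integrand of `Λ_(2,2)`. -/
theorem lamTwoTwo_integrand (u : Fin 4 → ℝ) :
    lamTwoTwo.integrand u = 1 / u 0 * (1 / (1 - u 1)) * (1 / u 2) * (1 / (1 - u 3)) := by
  show (∏ i : Fin 4, mzvForm ((MZV.binaryWord [2, 2]).getD i false) (u i)) = _
  rw [binaryWord_two_two]
  simp only [Fin.prod_univ_four, Fin.val_zero, Fin.val_one, Fin.val_two,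
    (show ((3 : Fin 4) : ℕ) = 3 from rfl), List.getD_cons_zero, List.getD_cons_succ,
    mzvForm_false, mzvForm_true]

/-- The integrand of `Λ_(3,1)`. -/
theorem lamThreeOne_integrand (u : Fin 4 → ℝ) :
    lamThreeOne.integrand u = 1 / u 0 * (1 / u 1) * (1 / (1 - u 2)) * (1 / (1 - u 3)) := by
  show (∏ i : Fin 4, mzvForm ((MZV.binaryWord [3, 1]).getD i false) (u i)) = _
  rw [binaryWord_three_one]
  simp only [Fin.prod_univ_four, Fin.val_zero, Fin.val_one, Fin.val_two,
    (show ((3 : Fin 4) : ℕ) = 3 from rfl), List.getD_cons_zero, List.getD_cons_succ,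
    mzvForm_false, mzvForm_true]

/-- The Fubini product `Λ₂ × Λ₂ = [{1>t₀>t₁>0} × {1>t₂>t₃>0}, ω₀(t₀)ω₁(t₁)ω₀(t₂)ω₁(t₃)]`. -/
def lamPair : IntegralRep 4 := lamTwo.prod lamTwo

/-- The domain of `Λ₂ × Λ₂`. -/
theorem mem_lamPair_domain {t : Fin 4 → ℝ} :
    t ∈ lamPair.domain ↔ (0 < t 1 ∧ t 1 < t 0 ∧ t 0 < 1) ∧ (0 < t 3 ∧ t 3 < t 2 ∧ t 2 < 1) := by
  show (fun i : Fin 2 => t (Fin.castAdd 2 i)) ∈ openOrderedSimplex 2 ∧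
      (fun j : Fin 2 => t (Fin.natAdd 2 j)) ∈ openOrderedSimplex 2 ↔ _
  rw [mem_openOrderedSimplex_two, mem_openOrderedSimplex_two]
  exact Iff.rfl

/-- The integrand of `Λ₂ × Λ₂`. -/
theorem lamPair_integrand (t : Fin 4 → ℝ) :
    lamPair.integrand t = 1 / t 0 * (1 / (1 - t 1)) * (1 / t 2 * (1 / (1 - t 3))) := by
  show (lamTwo.prod lamTwo).integrand t = _
  rw [IntegralRep.prod_integrand_eq, IntegralRep.prodFun_apply, lamTwo_integrand, lamTwo_integrand]
  rfl

/-! ## The six cells -/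

/-- The six compatible total orders of `t₀>t₁`, `t₂>t₃`, as the sequence of coordinates in
decreasing order. -/
def cellFun : Fin 6 → Fin 4 → Fin 4 :=
  ![![0, 1, 2, 3], ![0, 2, 1, 3], ![0, 2, 3, 1], ![2, 0, 1, 3], ![2, 0, 3, 1], ![2, 3, 0, 1]]

/-- Each is a permutation. -/
theorem cellFun_injective (k : Fin 6) : Function.Injective (cellFun k) := by
  fin_cases k <;> decide

/-- The cell permutations. -/
def cellPerm (k : Fin 6) : Fin 4 ≃ Fin 4 :=
  Equiv.ofBijective (cellFun k) (Finite.injective_iff_bijective.mp (cellFun_injective k))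

/-- Values of the cell permutations. -/
@[simp] theorem cellPerm_apply (k : Fin 6) (i : Fin 4) : cellPerm k i = cellFun k i := rfl

/-- The word carried by each cell: `0101 = ε(2,2)` on the first and last cell, `0011 = ε(3,1)`
on the four others. -/
def cellSource (k : Fin 6) : IntegralRep 4 := if k = 0 ∨ k = 5 then lamTwoTwo else lamThreeOne

/-- The cell representations: `Λ_s` pulled back along the sorting permutation. -/
def cellRep (k : Fin 6) : IntegralRep 4 := (cellSource k).reindex (cellPerm k)

/-- The domain of a cell representation: the coordinates in the prescribed order. -/
theorem mem_cellRep_domain {k : Fin 6} {t : Fin 4 → ℝ} :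
    t ∈ (cellRep k).domain ↔
      0 < t (cellFun k 3) ∧ t (cellFun k 3) < t (cellFun k 2) ∧
        t (cellFun k 2) < t (cellFun k 1) ∧ t (cellFun k 1) < t (cellFun k 0) ∧
          t (cellFun k 0) < 1 := by
  have hd : (cellSource k).domain = openOrderedSimplex 4 := by
    unfold cellSource; split_ifs <;> rfl
  simp only [cellRep, IntegralRep.reindex_domain, hd, mem_setOf_eq, mem_openOrderedSimplex_four,
    cellPerm_apply]

/-- The integrand of a cell representation is that of `Λ₂ × Λ₂`. -/
theorem cellRep_integrand (k : Fin 6) (t : Fin 4 → ℝ) :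
    (cellRep k).integrand t = lamPair.integrand t := by
  rw [lamPair_integrand]
  simp only [cellRep, IntegralRep.reindex_integrand, cellPerm_apply]
  fin_cases k <;>
    simp [cellSource, cellFun, lamTwoTwo_integrand, lamThreeOne_integrand] <;> ring

/-- Each cell lies in the product domain. -/
theorem cellRep_domain_subset (k : Fin 6) : (cellRep k).domain ⊆ lamPair.domain := by
  intro t ht
  rw [mem_cellRep_domain] at ht
  rw [mem_lamPair_domain]
  fin_cases k <;> simp [cellFun] at ht <;>
    (obtain ⟨h1, h2, h3, h4, h5⟩ := ht; refine ⟨⟨?_, ?_, ?_⟩, ?_, ?_, ?_⟩ <;> linarith)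

/-- Distinct cells are disjoint. -/
theorem cellRep_domain_disjoint {i j : Fin 6} (hij : i ≠ j) :
    (cellRep i).domain ∩ (cellRep j).domain = ∅ := by
  refine Set.eq_empty_of_forall_notMem fun t ⟨hi, hj⟩ => ?_
  rw [mem_cellRep_domain] at hi hj
  fin_cases i <;> fin_cases j <;> simp [cellFun] at hi hj hij <;> linarith

/-- **The cells cover `Λ₂ × Λ₂` up to ties.** -/
theorem lamPair_domain_diff_subset :
    lamPair.domain \ ⋃ k ∈ (Finset.univ : Finset (Fin 6)), (cellRep k).domain ⊆
      {t | t 0 = t 2} ∪ {t | t 1 = t 2} ∪ {t | t 0 = t 3} ∪ {t | t 1 = t 3} := by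
  rintro t ⟨ht, hnot⟩
  rw [mem_lamPair_domain] at ht
  obtain ⟨⟨h1, h10, h0⟩, h3, h32, h2⟩ := ht
  simp only [Finset.mem_univ, iUnion_true, mem_iUnion, not_exists] at hnot
  have hc : ∀ k, ¬ (0 < t (cellFun k 3) ∧ t (cellFun k 3) < t (cellFun k 2) ∧
      t (cellFun k 2) < t (cellFun k 1) ∧ t (cellFun k 1) < t (cellFun k 0) ∧
        t (cellFun k 0) < 1) := fun k hk => hnot k (mem_cellRep_domain.mpr hk)
  have c0 := hc 0; have c1 := hc 1; have c2 := hc 2; have c3 := hc 3; have c4 := hc 4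
  have c5 := hc 5
  simp only [cellFun, Matrix.cons_val_zero, Matrix.cons_val_one, Matrix.cons_val]
    at c0 c1 c2 c3 c4 c5
  simp only [mem_union, mem_setOf_eq]
  by_cases h02 : t 0 = t 2
  · exact Or.inl (Or.inl (Or.inl h02))
  by_cases h12 : t 1 = t 2
  · exact Or.inl (Or.inl (Or.inr h12))
  by_cases h03 : t 0 = t 3
  · exact Or.inl (Or.inr h03)
  by_cases h13 : t 1 = t 3
  · exact Or.inr h13
  exfalso
  rcases lt_or_gt_of_ne h02 with h02 | h20
  · -- `t₂` is the maximum
    rcases lt_or_gt_of_ne h03 with h03 | h30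
    · exact c5 ⟨h1, h10, h03, h32, h2⟩
    · rcases lt_or_gt_of_ne h13 with h13 | h31
      · exact c4 ⟨h1, h13, h30, h02, h2⟩
      · exact c3 ⟨h3, h31, h10, h02, h2⟩
  · -- `t₀` is the maximum
    rcases lt_or_gt_of_ne h12 with h12 | h21
    · rcases lt_or_gt_of_ne h13 with h13 | h31
      · exact c2 ⟨h1, h13, h32, h20, h0⟩
      · exact c1 ⟨h3, h31, h12, h20, h0⟩
    · exact c0 ⟨h3, h32, h21, h10, h0⟩

/-! ## The moves -/

/-- **Move (domain additivity, six-fold): `[Λ₂ × Λ₂] − Σₖ [cellₖ] ∈ relations`.** -/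
theorem lamPair_sub_sum_cells :
    of lamPair - ∑ k ∈ (Finset.univ : Finset (Fin 6)), of (cellRep k) ∈ relations := by
  refine of_sub_sum_of_mem_relations Finset.univ lamPair cellRep
    (fun k _ => measure_mono_null (fun t ht => (ht.2 (cellRep_domain_subset k ht.1)).elim)
      measure_empty)
    (fun k _ t _ => cellRep_integrand k t) ?_
    (fun i _ j _ hij => show volume ((cellRep i).domain ∩ (cellRep j).domain) = 0 by
      rw [cellRep_domain_disjoint hij, measure_empty])
  -- a tie `tᵢ = tⱼ` (`i ≠ j`) is Lebesgue-null: it lies in the kernel of `t ↦ tᵢ - tⱼ`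
  have tie : ∀ {i j : Fin 4}, i ≠ j → volume {t : Fin 4 → ℝ | t i = t j} = 0 := by
    intro i j hij
    let L : (Fin 4 → ℝ) →ₗ[ℝ] ℝ :=
      LinearMap.proj (R := ℝ) (φ := fun _ : Fin 4 => ℝ) i -
        LinearMap.proj (R := ℝ) (φ := fun _ : Fin 4 => ℝ) j
    have hS : LinearMap.ker L ≠ ⊤ := by
      intro h
      have h1 : (Pi.single i 1 : Fin 4 → ℝ) ∈ LinearMap.ker L := h ▸ Submodule.mem_top
      rw [LinearMap.mem_ker] at h1
      simp [L, hij.symm] at h1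
    refine measure_mono_null (fun t ht => ?_)
      (Measure.addHaar_submodule volume (LinearMap.ker L) hS)
    have ht' : t i = t j := ht
    rw [SetLike.mem_coe, LinearMap.mem_ker]
    simp [L, ht']
  refine measure_mono_null lamPair_domain_diff_subset ?_
  exact measure_union_null (measure_union_null (measure_union_null
    (tie (by decide)) (tie (by decide))) (tie (by decide))) (tie (by decide))

/-- **Moves (changes of variables): each cell is a coordinate permutation of `Λ_(2,2)` or
`Λ_(3,1)`.** -/
theorem cellSource_sub_cellRep (k : Fin 6) : of (cellSource k) - of (cellRep k) ∈ relations :=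
  of_sub_of_reindex_mem_relations _ _

/-- The sources: `Λ_(2,2)` twice, `Λ_(3,1)` four times. -/
theorem sum_of_cellSource :
    ∑ k ∈ (Finset.univ : Finset (Fin 6)), of (cellSource k) =
      2 • of lamTwoTwo + 4 • of lamThreeOne := by
  simp only [Fin.sum_univ_succ, Fin.sum_univ_zero, cellSource]
  simp +decide only [if_true, if_false]
  abel

/-- **The shuffle product `Λ₂ × Λ₂ ≡ 2Λ_(2,2) + 4Λ_(3,1)` inside the rules**: one six-fold domain
decomposition (up to the null ties) and six coordinate permutations. -/
theorem kz_shuffle_two_two :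
    of lamPair - 2 • of lamTwoTwo - 4 • of lamThreeOne ∈ relations := by
  have h1 := lamPair_sub_sum_cells
  have h2 : ∑ k ∈ (Finset.univ : Finset (Fin 6)), (of (cellSource k) - of (cellRep k)) ∈
      relations := sum_mem fun k _ => cellSource_sub_cellRep k
  rw [Finset.sum_sub_distrib, sum_of_cellSource] at h2
  convert sub_mem h1 h2 using 1
  abel

/-- **The weight-4 double shuffle relation inside the rules: `4·[Λ_(3,1)] − [Λ₄] ∈ relations`**
(stuffle minus shuffle). -/
theorem kz_four_threeOne_sub_four : 4 • of lamThreeOne - of lamFour ∈ relations := by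
  have hs : of lamPair - 2 • of lamTwoTwo - of lamFour ∈ relations :=
    kz_stuffle_two_two_simplex
  convert sub_mem hs kz_shuffle_two_two using 1
  abel

/-- **`4ζ(3,1) = ζ(4)`**, read off from the moves. -/
theorem four_mul_zeta_three_one : 4 * multipleZeta [3, 1] = zetaValue 4 := by
  have h := relations_le_ker_eval_holds kz_four_threeOne_sub_four
  rw [AddMonoidHom.mem_ker, map_sub, map_nsmul, eval_of, eval_of, sub_eq_zero,
    show lamThreeOne.value = multipleZeta [3, 1] from mzvSimplexRep_value _ _,
    show lamFour.value = multipleZeta [4] from simplexZetaRep_value _,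
    multipleZeta_singleton_eq_zetaValue (by norm_num)] at h
  simpa [nsmul_eq_mul] using h

/-- The box form: `4·[B_(3,1)] − [B₄] ∈ relations`, with `B_(3,1) = [(0,1)⁴,
x₀x₁x₂/(x₀x₁(1-x₀x₁x₂)(1-x₀x₁x₂x₃))]` the nested-geometric box representation of
`SoloBlindMZVBox`. -/
theorem kz_four_boxThreeOne_sub_boxFour :
    4 • of (boxMZVRep [3, 1] isAdmissible_three_one) - of boxFour ∈ relations := by
  have a : mkQ (of (boxMZVRep [3, 1] isAdmissible_three_one)) = mkQ (of lamThreeOne) :=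
    mkQ_eq_mkQ_iff.mpr (kz_mzv_box _ _)
  have b : mkQ (of boxFour) = mkQ (of lamFour) := mkQ_eq_mkQ_iff.mpr (kz_zeta_box_simplex _)
  refine mkQ_eq_mkQ_iff.mp ?_
  rw [map_nsmul, a, b, ← map_nsmul]
  exact mkQ_eq_mkQ_iff.mpr kz_four_threeOne_sub_four

end SoloBlind

end Summit.KontsevichZagierPeriods.KontsevichZagierPeriods.Theorems
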